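import Summits.QuantumFields.YangMills.Theorems.F4SubCurvatureDoorShortRootRigidityOddModeSplitRegistered
import Summits.QuantumFields.YangMills.Theorems.F4SubCurvatureDoorShortRootRigidityTrigonalSectoralSpan
import Summits.QuantumFields.YangMills.Theorems.F4SubCurvatureDoorShortRootRigidityTrigonalDefs
import Summits.QuantumFields.YangMills.Theorems.F4SubCurvatureDoorShortRootRigiditySchwarzReflection
import Literature.Algebra.Polynomial.LaplacianOrthogonalInvariance
import Mathlib
import HarnessLib

/-!
# `TrigonalInjectivityAll` — piece h₃ of the typed split of `:146 stub_oddModeRigidity`, BY NAME (bridge B)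

Crux ⟨stmt-QuantumFields-23035⟩ `ShortRootRigidity`, registered stub `:146 stub_oddModeRigidity : OddModeRigidity`, typed split
`OddModeRigidity ⇐ AnalyticHalf ∧ TorusReduction ∧ TrigonalInjectivityAll` (`Cruxes/ShortRootRigidity/Lines/odd_mode_split.lean`,
planner ym-idea-3 g21; vocabulary restated in `Theorems/…OddModeSplitRegistered.lean`).

The split states trigonal injectivity in TRACE form in the orthonormal frame `f₁ = (1,−1,0)/√2`, `f₂ = (1,1,−2)/√6` of the plane
`x+y+z = 0` (`TrigonalInjectivity s`: `… → (∃ a, ∀ u v, Y(planePt u v) = a·Re(u+iv)^{6s}) → Y = 0`), while the sub-skeleton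
`Lines/trigonal_injectivity.lean` proves the E-free RATIONAL form `TrigonalInjectivityQ s` (hypothesis `Δ(Y∘proj) = 0`;
✓`trigonalInjectivityQ_holds`, `Theorems/…TrigonalSectoralSpan.lean`).  This file is the bridge (critic idea-crit-4 g10's «bridge B»):
* `bind₁_linSubst_flipMat` / `ohInvariant_of` — the matrix sign flips of the sub-skeleton are the `aeval` sign flips of the split;
* `proj_eq_planePt` — `proj p = planePt (√2(p₀−p₁)/2) (√6(p₀+p₁−2p₂)/6)`;
* `re_pow_planePt` — `Re(u+iv)^{6s} = 2^{3s}·E_s(p)` for these `u, v` (`u+iv = √2·e^{iπ/3}·conj(α+iβ)` and `(e^{iπ/3})^{6s} = 1`: the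
  real axes `(1,−1,0)` and `(1,0,−1)` make an angle of 60°), so the trace hypothesis gives `Y∘proj = a·2^{3s}·E_s`, harmonic;
* `trigonalInjectivity_holds : 1 ≤ s → TrigonalInjectivity s`, `trigonalInjectivityAll_holds : TrigonalInjectivityAll` BY NAME, and
  `oddModeRigidity_of_analyticHalf_of_torusReduction : AnalyticHalf → TorusReduction → OddModeRigidity` (what is left of `:146`).

HONEST LABEL: `AnalyticHalf` (R-O1) and `TorusReduction` (§2 of `TrigonalInjectivity.md`) are OPEN; `:146`, ⟨23035⟩, ⟨23125⟩, R2d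
OPEN; the Yang–Mills mass gap is NOT proved; no summit is proved by a line.
-/

noncomputable section

namespace Summit.QuantumFields.YangMills.Theorems.F4SubCurvatureDoorTrigonalInjectivityAllByName

open MvPolynomial
open scoped BigOperators
open Literature.Algebra.Polynomial
open Summit.QuantumFields.YangMills.Theorems.F4SubCurvatureDoorOddModeSplitRegistered
  (OddModeRigidity AnalyticHalf planePt TrigonalInjectivity TrigonalInjectivityAll TorusReduction oddModeRigidity_of_split)
open Summit.QuantumFields.YangMills.Theorems.F4SubCurvatureDoorTrigonalLine (P3 lap J3 Pm flipMat OhInvariant TrigonalInjectivityQ Esect)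
open Summit.QuantumFields.YangMills.Theorems.F4SubCurvatureDoorSchwarzReflection (laplacian3)
open Summit.QuantumFields.YangMills.Theorems.F4SubCurvatureDoorTrigonalSectoralSpan
  (trigonalInjectivityQ_holds laplacian3_Esect eval_Esect re_pow_even proj_mulVec)

/-- `ω = e^{iπ/3} = 1/2 + (√3/2) i` satisfies `ω⁶ = 1`. -/
theorem omega_pow_six : ((((1 : ℝ) / 2 : ℝ) : ℂ) + ((Real.sqrt 3 / 2 : ℝ) : ℂ) * Complex.I) ^ 6 = 1 := by
  set ω : ℂ := (((1 : ℝ) / 2 : ℝ) : ℂ) + ((Real.sqrt 3 / 2 : ℝ) : ℂ) * Complex.I with hω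
  have h3 : Real.sqrt 3 ^ 2 = 3 := Real.sq_sqrt (by norm_num)
  have h2 : ω ^ 2 = ω - 1 := by
    apply Complex.ext
    · simp only [hω, sq, Complex.mul_re, Complex.add_re, Complex.add_im, Complex.mul_im, Complex.ofReal_re, Complex.ofReal_im,
        Complex.I_re, Complex.I_im, Complex.sub_re, Complex.one_re]
      linear_combination (-(1 : ℝ) / 4) * h3
    · simp only [hω, sq, Complex.mul_re, Complex.add_re, Complex.add_im, Complex.mul_im, Complex.ofReal_re, Complex.ofReal_im,
        Complex.I_re, Complex.I_im, Complex.sub_im, Complex.one_im]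
      ring
  have hcube : ω ^ 3 = -1 := by linear_combination (ω + 1) * h2
  calc ω ^ 6 = (ω ^ 3) ^ 2 := by ring
    _ = 1 := by rw [hcube]; norm_num

/-- The sub-skeleton's matrix sign flip is the split's `aeval` sign flip. -/
theorem bind₁_linSubst_flipMat (i : Fin 3) (Y : P3) :
    bind₁ (linSubst (flipMat i)) Y = aeval (fun j : Fin 3 => if j = i then -(X j : MvPolynomial (Fin 3) ℝ) else X j) Y := by
  rw [aeval_eq_bind₁]
  have hf : linSubst (flipMat i) = fun j : Fin 3 => if j = i then -(X j : MvPolynomial (Fin 3) ℝ) else X j := by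
    funext j
    simp only [linSubst, flipMat, Fin.sum_univ_three, Matrix.diagonal]
    fin_cases i <;> fin_cases j <;> simp
  rw [hf]

/-- `O_h`-invariance in the sub-skeleton's sense from the split's hypotheses. -/
theorem ohInvariant_of (Y : P3) (hperm : ∀ σ : Equiv.Perm (Fin 3), rename σ Y = Y)
    (hflip : ∀ i : Fin 3, aeval (fun j : Fin 3 => if j = i then -(X j : MvPolynomial (Fin 3) ℝ) else X j) Y = Y) :
    OhInvariant Y :=
  ⟨hperm, fun i => by rw [bind₁_linSubst_flipMat]; exact hflip i⟩

/-- The projection in the split's frame: `proj p = planePt (√2(p₀−p₁)/2) (√6(p₀+p₁−2p₂)/6)`. -/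
theorem proj_eq_planePt (p : Fin 3 → ℝ) :
    Pm.mulVec p = planePt (Real.sqrt 2 * (p 0 - p 1) / 2) (Real.sqrt 6 * (p 0 + p 1 - 2 * p 2) / 6) := by
  rw [proj_mulVec]
  have h2 : Real.sqrt 2 ≠ 0 := by positivity
  have h6 : Real.sqrt 6 ≠ 0 := by positivity
  funext i
  fin_cases i <;> simp [planePt] <;> field_simp <;> ring

/-- **The sectoral trace in the split's frame is `2^{3s} E_s`**: `Re (u + iv)^{6s} = 2^{3s} E_s(p)` for `u = √2(p₀−p₁)/2`,
`v = √6(p₀+p₁−2p₂)/6` — because `u + iv = √2 · e^{iπ/3} · conj(α + iβ)` and `(e^{iπ/3})^{6s} = 1` (the two real axes `(1,−1,0)` and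
`(1,0,−1)` of the plane make an angle of 60°). -/
theorem re_pow_planePt (s : ℕ) (p : Fin 3 → ℝ) :
    ((((Real.sqrt 2 * (p 0 - p 1) / 2 : ℝ) : ℂ) + ((Real.sqrt 6 * (p 0 + p 1 - 2 * p 2) / 6 : ℝ) : ℂ) * Complex.I) ^ (6 * s)).re
      = 2 ^ (3 * s) * eval p (Esect s) := by
  set α : ℝ := (p 0 - p 2) / 2 with hα
  set b : ℝ := Real.sqrt 3 / 2 * ((p 0 - 2 * p 1 + p 2) / 3) with hb
  set ω : ℂ := (((1 : ℝ) / 2 : ℝ) : ℂ) + ((Real.sqrt 3 / 2 : ℝ) : ℂ) * Complex.I with hω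
  have h3 : Real.sqrt 3 ^ 2 = 3 := Real.sq_sqrt (by norm_num)
  have h6 : Real.sqrt 6 = Real.sqrt 2 * Real.sqrt 3 := by
    rw [← Real.sqrt_mul (by norm_num : (0:ℝ) ≤ 2)]; norm_num
  have hconj : (starRingEnd ℂ) ((α : ℂ) + (b : ℂ) * Complex.I) = (α : ℂ) - (b : ℂ) * Complex.I := by
    rw [map_add, map_mul, Complex.conj_ofReal, Complex.conj_ofReal, Complex.conj_I]
    ring
  have hlin : ((Real.sqrt 2 * (p 0 - p 1) / 2 : ℝ) : ℂ) + ((Real.sqrt 6 * (p 0 + p 1 - 2 * p 2) / 6 : ℝ) : ℂ) * Complex.I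
      = (Real.sqrt 2 : ℂ) * (ω * (starRingEnd ℂ) ((α : ℂ) + (b : ℂ) * Complex.I)) := by
    rw [h6, hconj]
    apply Complex.ext
    · simp only [hω, Complex.mul_re, Complex.add_re, Complex.add_im, Complex.mul_im, Complex.ofReal_re, Complex.ofReal_im,
        Complex.I_re, Complex.I_im, Complex.sub_re, Complex.sub_im]
      simp only [hα, hb]
      linear_combination (-(Real.sqrt 2) * (p 0 - 2 * p 1 + p 2) / 12) * h3
    · simp only [hω, Complex.mul_re, Complex.add_re, Complex.add_im, Complex.mul_im, Complex.ofReal_re, Complex.ofReal_im,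
        Complex.I_re, Complex.I_im, Complex.sub_re, Complex.sub_im]
      simp only [hα, hb]
      ring
  have hs2 : ((Real.sqrt 2 : ℝ) : ℂ) ^ (6 * s) = (((2 : ℝ) ^ (3 * s) : ℝ) : ℂ) := by
    have h : (Real.sqrt 2) ^ (6 * s) = (2 : ℝ) ^ (3 * s) := by
      rw [show 6 * s = 2 * (3 * s) by ring, pow_mul, Real.sq_sqrt (by norm_num : (0:ℝ) ≤ 2)]
    rw [← Complex.ofReal_pow, h]
  have hωs : ω ^ (6 * s) = 1 := by rw [pow_mul, omega_pow_six, one_pow]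
  rw [hlin, mul_pow, mul_pow, hs2, hωs, one_mul, ← map_pow, Complex.re_ofReal_mul, Complex.conj_re]
  -- `Re λ^{6s} = E_s(p)`
  have hbsq : b ^ 2 = (p 0 - 2 * p 1 + p 2) ^ 2 / 12 := by
    rw [hb, mul_pow, div_pow, h3]; ring
  rw [eval_Esect, show 6 * s = 2 * (3 * s) by ring, re_pow_even, hbsq]

/-- The split's trace hypothesis makes `Y∘proj = (a·2^{3s})·E_s`, hence `Y∘proj` is harmonic. -/
theorem lap_proj_eq_zero (s : ℕ) (Y : P3) (a : ℝ)
    (ha : ∀ u v : ℝ, eval (planePt u v) Y = a * (((u : ℂ) + (v : ℂ) * Complex.I) ^ (6 * s)).re) :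
    lap (bind₁ (linSubst Pm) Y) = 0 := by
  have hZ : bind₁ (linSubst Pm) Y = (a * 2 ^ (3 * s)) • Esect s := by
    refine MvPolynomial.funext fun p => ?_
    rw [eval_bind₁_linSubst, proj_eq_planePt, ha, re_pow_planePt, smul_eval]
    ring
  rw [hZ]
  show laplacian3 ((a * 2 ^ (3 * s)) • Esect s) = 0
  have h : laplacian3 ((a * 2 ^ (3 * s)) • Esect s) = (a * 2 ^ (3 * s)) • laplacian3 (Esect s) := by
    simp only [laplacian3, Derivation.map_smul, Finset.smul_sum]
  rw [h, laplacian3_Esect, smul_zero]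

/-- **TRIGONAL INJECTIVITY at level `s ≥ 1` in the split's trace form (`odd_mode_split.lean :57`), BY NAME + SIGNATURE**, from the
E-free rational form `trigonalInjectivityQ_holds`. -/
theorem trigonalInjectivity_holds (s : ℕ) (hs : 1 ≤ s) : TrigonalInjectivity s := by
  intro Y hY hh hperm hflip htrace
  obtain ⟨a, ha⟩ := htrace
  exact trigonalInjectivityQ_holds s hs Y hY hh (ohInvariant_of Y hperm hflip) (lap_proj_eq_zero s Y a ha)

/-- **`TrigonalInjectivityAll` — piece `h₃` of the typed split of `:146 stub_oddModeRigidity`, DISCHARGED BY NAME.**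
HONEST LABEL: `AnalyticHalf` (R-O1) and `TorusReduction` (§2) are OPEN; `:146`, ⟨23035⟩, ⟨23125⟩ OPEN; YM mass gap NOT proved. -/
theorem trigonalInjectivityAll_holds : TrigonalInjectivityAll := fun s hs => trigonalInjectivity_holds s hs

/-- What remains of `:146` after this file: `OddModeRigidity ⇐ AnalyticHalf ∧ TorusReduction`. -/
theorem oddModeRigidity_of_analyticHalf_of_torusReduction (h₁ : AnalyticHalf) (h₂ : TorusReduction) : OddModeRigidity :=
  oddModeRigidity_of_split h₁ h₂ trigonalInjectivityAll_holds

end Summit.QuantumFields.YangMills.Theorems.F4SubCurvatureDoorTrigonalInjectivityAllByName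

end
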